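import Literature.Probability.RandomPlanarGeometry.HexSAWSurfaceWallRenewalSlackFourThreeDownLaw
import Literature.Probability.RandomPlanarGeometry.HexSAWSurfaceWallRenewalSlackFourTwoDown
import Literature.Probability.RandomPlanarGeometry.HexSAWSurfaceWallRenewalIteratedGap
import HarnessLib

/-!
# Hexagonal-lattice SAWs at a surface: the slack-four row of the wall-renewal census reduces to its four-down stratum

For `k ≥ 2` and `m = 6k + 4`, an irreducible positive wall bridge of length `m` with `k` surface visits has `2`, `3` or `4`
down steps (`slack_four_counts` of `…IteratedGap`: the iterated-gap inequality `2·#stepsD + 6·visits ≤ m + 4` and its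
companion lower bound `2 ≤ #stepsD`).  With the two-down law
`card_filter_visits_two_down` (`= k + 3`, `…SlackFourTwoDown`) and the three-down law `two_mul_card_filter_visits_three_down`
(`= (k−1)(2k²+3k−4)/2 + 1`, `…SlackFourThreeDownLaw`) the slack-four census `N(6k+4, k) = #{ω ∈ ipwb (6k+4) : visits = k}`
is therefore its four-down stratum plus an explicit cubic:
`2·N(6k+4, k) = 2·#{visits = k, #stepsD = 4} + (k−1)(2k²+3k−4) + 2k + 8` (`two_mul_card_filter_visits_slack_four`).
(The lane's enumeration: the four-down stratum has `3, 27, 129` members for `k = 3, 4, 5`.)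

References: hexagonal-lattice SAW [DuminilCopinSmirnov2012]; wall-renewal (irreducible bridge) decomposition and its census
[MadrasSlade1993, §4.2 (Definition 4.2.1, p. 90; (4.2.2)), §1.2 (Definition 1.2.4, p. 11)]; enumeration by profile
[EntingJensen2009, §7.4.2, Fig. 7.10]; surface fugacity `1 + √2` [BeatonBousquetMelouDeGierDuminilCopinGuttmann2014, §3.1].
-/

namespace Literature.Probability.RandomPlanarGeometry.SAW.HexBW.Wall

open Finset Filter Function
open Literature.Probability.LatticeModels Literature.Probability.Percolation SimpleGraph

variable {n : ℕ} {ω : ℕ → Site 2}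

/-- ★★ **The slack-four row of the census reduces to its four-down stratum.**  For `k ≥ 2` and `m = 6k + 4`,
`2·#{ω ∈ ipwb m : visits = k} = 2·#{ω ∈ ipwb m : visits = k, #stepsD = 4} + (k−1)(2k²+3k−4) + 2k + 8`
(strata `#stepsD ∈ {2, 3, 4}` by `slack_four_counts`; two-down law `k + 3`; three-down law `(k−1)(2k²+3k−4)/2 + 1`).
OURS.
[cite: MadrasSlade1993, §4.2, Definition 4.2.1 (p. 90), (4.2.2)] [cite: EntingJensen2009, §7.4.2, Fig. 7.10]
[cite: BeatonBousquetMelouDeGierDuminilCopinGuttmann2014, §3.1] -/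
theorem two_mul_card_filter_visits_slack_four {k m : ℕ} (hk : 2 ≤ k) (hm : m = 6 * k + 4) :
    2 * #((ipwb m).filter fun ω => visits m ω = k) =
      2 * #((ipwb m).filter fun ω => visits m ω = k ∧ #(stepsD m ω) = 4) + (k - 1) * (2 * k * k + 3 * k - 4) +
        2 * k + 8 := by
  classical
  set P := (ipwb m).filter fun ω => visits m ω = k with hP
  have e2 : #(P.filter fun ω => #(stepsD m ω) = 2) = k + 3 := by
    rw [hP, Finset.filter_filter]; convert card_filter_visits_two_down hk hm
  have e3 : 2 * #(P.filter fun ω => #(stepsD m ω) = 3) = (k - 1) * (2 * k * k + 3 * k - 4) + 2 := by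
    rw [hP, Finset.filter_filter]; convert two_mul_card_filter_visits_three_down hk hm
  have e4 : #(P.filter fun ω => #(stepsD m ω) = 4) = #((ipwb m).filter fun ω => visits m ω = k ∧ #(stepsD m ω) = 4) := by
    rw [hP, Finset.filter_filter]
  have s1 := Finset.card_filter_add_card_filter_not (s := P) (fun ω => #(stepsD m ω) = 2)
  have s2 := Finset.card_filter_add_card_filter_not (s := P.filter fun ω => ¬ #(stepsD m ω) = 2)
    (fun ω => #(stepsD m ω) = 3)
  have e5 : (P.filter fun ω => ¬ #(stepsD m ω) = 2).filter (fun ω => #(stepsD m ω) = 3) =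
      P.filter fun ω => #(stepsD m ω) = 3 := by
    rw [Finset.filter_filter]
    exact Finset.filter_congr fun ω _ => by omega
  have e6 : (P.filter fun ω => ¬ #(stepsD m ω) = 2).filter (fun ω => ¬ #(stepsD m ω) = 3) =
      P.filter fun ω => #(stepsD m ω) = 4 := by
    rw [Finset.filter_filter]
    refine Finset.filter_congr fun ω hω => ?_
    rw [hP, Finset.mem_filter] at hω
    obtain ⟨-, -, hD2, hD4, -⟩ := slack_four_counts hk hm hω.1 hω.2
    omega
  rw [e5, e6] at s2
  omega

end Literature.Probability.RandomPlanarGeometry.SAW.HexBW.Wall
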